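import Literature.Computability.Cryptography.QubitRegister
import Literature.Computability.Cryptography.QuantumCircuit
import HarnessLib

/-!
# The `T`-count of a Clifford+`T` circuit (trunk CryptoQuantFine, topic Cryptography)

For a quantum circuit `C : QCircuit cliffordT n` over the Clifford+`T` gate set
`cliffordT = {H, S, T, CNOT}` (`QubitRegister.lean`) with the circuit syntax of
`QuantumCircuit.lean` (a list `C.gates` of placed gates `QGate.gate g e` and oracle queries
`QGate.oracle k e`), the **`T`-count** `C.tCount` is the number of gates of `C` that are
placements of the non-Clifford gate `T` (`List.countP` of the structural recogniser
`QGate.isT`; the sum-of-indicators form is `tCount_eq_sum_map`). It is the cost parameter of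
stabiliser-rank simulation of Clifford-dominated circuits (Bravyi–Gosset 2016: classical simulation in time
`poly(n, m) · 2^{0.468 t}` for `T`-count `t`) and the standard resource count of Clifford+`T`
synthesis (Amy–Maslov–Mosca–Roetteler 2013).

Contents (namespace `Literature.CryptoQuantFine`): `QGate.isT` (Boolean recogniser of `T` placements,
by structural recursion; oracle gates are not `T` gates), `QCircuit.tCount` (sum over the gate
list), and the API `tCount_eq_countP` (agreement with the inline `List.countP` form),
`tCount_nil`, `tCount_cons`, `tCount_append`, `tCount_eq_zero_iff`
(`C.tCount = 0 ↔ ∀ q ∈ C.gates, ∀ e, q ≠ QGate.gate CliffordTOp.T e`), `tCount_le_size`.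
Wanted by route `QuantumAdvantage/Dequantize` (cruxes #3, #4).

Mathlib has no quantum circuits; we use `List.countP`, `List.sum`.

## References

* S. Bravyi, D. Gosset, *Improved classical simulation of quantum circuits dominated by Clifford
  gates*, Phys. Rev. Lett. 116 (2016) 250501, §I (the `T`-count `t` as the simulation cost
  parameter).
* M. Amy, D. Maslov, M. Mosca, M. Roetteler, *A meet-in-the-middle algorithm for fast synthesis
  of depth-optimal quantum circuits*, IEEE TCAD 32 (2013) (`T`-count / `T`-depth).
-/

namespace Literature.Computability.Cryptography

variable {n : ℕ}

namespace QGate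

/-- `q.isT`: the placed gate `q` of a Clifford+`T` circuit is a placement of the `T` gate
(`QGate.gate CliffordTOp.T e` for some wire embedding `e`); oracle queries and `H`, `S`, `CNOT`
placements are not. Structural recursion on the gate syntax. [cite: BravyiGosset2016, §I] -/
def isT : QGate cliffordT n → Bool
  | .gate .T _ => true
  | .gate .H _ => false
  | .gate .S _ => false
  | .gate .CNOT _ => false
  | .oracle _ _ => false

/-- A `T` placement is recognised. [folklore] -/
@[simp] theorem isT_gate_T (e : Fin (cliffordT.arity CliffordTOp.T) ↪ Fin n) :
    isT (QGate.gate CliffordTOp.T e) = true := rfl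

/-- `H` placements are not `T` gates. [folklore] -/
@[simp] theorem isT_gate_H (e : Fin (cliffordT.arity CliffordTOp.H) ↪ Fin n) :
    isT (QGate.gate CliffordTOp.H e) = false := rfl

/-- `S` placements are not `T` gates. [folklore] -/
@[simp] theorem isT_gate_S (e : Fin (cliffordT.arity CliffordTOp.S) ↪ Fin n) :
    isT (QGate.gate CliffordTOp.S e) = false := rfl

/-- `CNOT` placements are not `T` gates. [folklore] -/
@[simp] theorem isT_gate_CNOT (e : Fin (cliffordT.arity CliffordTOp.CNOT) ↪ Fin n) :
    isT (QGate.gate CliffordTOp.CNOT e) = false := rfl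

/-- Oracle queries are not `T` gates. [folklore] -/
@[simp] theorem isT_oracle (k : ℕ) (e : Fin (k + 1) ↪ Fin n) :
    isT (QGate.oracle (G := cliffordT) k e) = false := rfl

/-- `q.isT` holds iff `q` is literally `QGate.gate CliffordTOp.T e` for some placement `e`.
[folklore] -/
theorem isT_eq_true_iff (q : QGate cliffordT n) :
    q.isT = true ↔ ∃ e, q = QGate.gate CliffordTOp.T e := by
  constructor
  · intro h
    match q, h with
    | .gate .T e, _ => exact ⟨e, rfl⟩
  · rintro ⟨e, rfl⟩
    rfl

end QGate

namespace QCircuit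

/-- The **`T`-count** of a Clifford+`T` circuit: the number of its gates that are placements of
`T` (each contributing `1`; `H`, `S`, `CNOT` and oracle queries contribute `0`), summed over the
gate list. [cite: BravyiGosset2016, §I] -/
def tCount (C : QCircuit cliffordT n) : ℕ :=
  C.gates.countP fun q => q.isT

/-- The `T`-count is the `List.countP` of `QGate.isT` over the gate list (the inline form;
definitional). [folklore] -/
theorem tCount_eq_countP (C : QCircuit cliffordT n) :
    C.tCount = C.gates.countP fun q => q.isT := rfl

/-- The `T`-count as a sum of indicators over the gate list ("each `T` placement contributes
`1`, every other gate `0`"). [folklore] -/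
theorem tCount_eq_sum_map (C : QCircuit cliffordT n) :
    C.tCount = (C.gates.map fun q => if q.isT then 1 else 0).sum := by
  rcases C with ⟨l⟩
  induction l with
  | nil => rfl
  | cons q l ih =>
    simp only [tCount, List.countP_cons, List.map_cons, List.sum_cons] at ih ⊢
    rw [ih]; split <;> omega

/-- The empty circuit has `T`-count `0`. [folklore] -/
@[simp] theorem tCount_nil : tCount (⟨[]⟩ : QCircuit cliffordT n) = 0 := rfl

/-- Prepending a gate adds its `T`-indicator. [folklore] -/
@[simp] theorem tCount_cons (q : QGate cliffordT n) (l : List (QGate cliffordT n)) :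
    tCount ⟨q :: l⟩ = tCount ⟨l⟩ + (if q.isT then 1 else 0) := by
  simp [tCount, List.countP_cons]

/-- The `T`-count is additive under sequential composition. [cite: BravyiGosset2016, §I] -/
@[simp] theorem tCount_append (C D : QCircuit cliffordT n) :
    (C.append D).tCount = C.tCount + D.tCount := by
  simp [tCount, List.countP_append]

/-- A circuit has `T`-count `0` iff none of its gates is a `T` placement, i.e. it is a Clifford
circuit with oracle queries. [cite: BravyiGosset2016, §I] -/
theorem tCount_eq_zero_iff (C : QCircuit cliffordT n) :
    C.tCount = 0 ↔ ∀ q ∈ C.gates, ∀ e, q ≠ QGate.gate CliffordTOp.T e := by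
  rw [tCount_eq_countP, List.countP_eq_zero]
  refine forall₂_congr fun q _ => ?_
  rw [← not_exists, ← QGate.isT_eq_true_iff]

/-- The `T`-count is at most the size. [folklore] -/
theorem tCount_le_size (C : QCircuit cliffordT n) : C.tCount ≤ C.size := by
  rw [tCount_eq_countP, size]
  exact List.countP_le_length

end QCircuit

end Literature.Computability.Cryptography
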